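import Mathlib
import Literature.MathematicalPhysics.QuantumFieldTheory.Balaban1983to89.B10LargeFieldSum
import Literature.MathematicalPhysics.QuantumFieldTheory.Balaban1983to89.B10Eq38TorusDomains
import Literature.MathematicalPhysics.QuantumFieldTheory.Balaban1983to89.B3TorusRadialSums

/-!
# `Balaban1983to89.B10Eq39CollarVolume` — [Balaban1985UV3] (39) p. 266, the rule of pp. 257 / 268 and the volume terms
# «Σ_{j=0}^{k−1} O(log g_j⁻¹)|Z_j|» of (41) p. 266 / (66) p. 273: THE COLLAR VOLUME COUNT ON PRINT'S TORUS — every site of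
# `Z_j = Ω_{j+1}ᶜ` lies within the accumulated collar widths of a large-field point of some scale `i ≤ j`, and
# `|Z_j| ≤ (Lʲ)^d Σ_{i≤j} 4|S_i| (c_g x(g_i)^{r₀})^d` — the geometric leaf `ZvolCover` of the cell's kernel closure of Sect. D
# («the analysis of Sect. 3.C [9], which is model independent») INSTANTIATED on the torus rule WITH BODY of `…B10Eq38TorusDomains`

T. Bałaban, *Ultraviolet stability of three-dimensional lattice pure gauge field theories*, Commun. Math. Phys. **102**,
255–275 (1985) [Balaban1985UV3] (cell paper B10; held `paper:balaban1985-cmp102-uv-stability-3d`, journal page = PDF page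
+ 254; pp. 257, 258, 266, 268, 273, 274 = [PDF 3, 4, 12, 14, 19, 20] re-read 2026-08-25 on the text layers `p0003.txt`,
`p0004.txt`, `p0012.txt`, `p0014.txt`, `p0019.txt`, `p0020.txt`; the displays are quoted in the forms already verified on the
page renders by the sibling modules `…B10LargeField`, `…B10LargeFieldSum`, `…B10Eq38TorusDomains`).  «…» = verbatim.

HONEST FRAMING.  Kernel bookkeeping of the LATTICE GEOMETRY of [Balaban1985UV3] Sects. A/B/D on the cell's torus carrier of
record (YM-PLAN Track A, DAG node N08 = [B10], seat `pub-ymgap-dag-n08-b`, «first missing estimate» lane); one finite torus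
at fixed spacing; Bałaban AS PRINTED with page locators.  NOTHING here asserts (41), (5), Theorem 1 or Theorem 2, and nothing
is claimed about the continuum, ℝ³/ℝ⁴, OS axioms, the mass gap or the Clay problem.

## The printed text

* p. 257 [PDF 3]: «Next we proceed as in [9], that is to each term of the decomposition we assign a subset Ω₁ ⊂ T₁ defined as
  a union of big blocks, i.e. blocks of the size M₁, of the unit lattice T₁, such that their distances to P are > RM₁. We
  take R = R₁(1 + log g₀⁻¹)^{r₀} = R₁r(g₀). By this definition p ⊂ Ω₁ᶜ, in fact dist(P, Ω₁) > RM₁».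
* p. 258 [PDF 4], after (11): «This small factor controls the part of the integral over a neighbourhood of the plaquette
  p, for example a neighbourhood of the radius RM₁, as in [9]. Thus the subintegral over Ω₁ᶜ is controlled by the small
  factors connected with ζ_{Ω₁ᶜ}».
* p. 266 [PDF 12]: «the only difference is that we take blocks with distances to P ∪ Ω₁ᶜ greater than RM₁, where
  R = R₁r(g₁). Thus we obtain a sequence of domains Ω₁ ⊃ Ω₂ ⊃ … ⊃ Ω_k, Ω_j ⊂ T_η, (38) satisfying the conditions
  (Lʲη)⁻¹ dist(Ω_jᶜ, Ω_{j+1}) > R(g_j)M₁, R(g_j) = R₁r(g_j), (39)  Ω_j is a union of big blocks of the size M₁Lʲη.» and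
  «we denote Z_j = Ω_{j+1}^{(j)c} ⊂ T^{(j)}_{Lʲη}»; (41) with the volume terms «+ Σ_{j=0}^{k−1} O(log g_j⁻¹)|Z_j|» and «Here
  the sets Z_j are rescaled to the unit scale.»
* p. 268 [PDF 14]: «We define the set Ω^{(k)}_{k+1} as a union of big blocks of the lattice T₁^{(k)}, with distances to
  P ∪ Ω_k^{(k)c} greater than R(g_k)M₁» and «Z_k = B(Λ_{k+1})ᶜ».
* p. 273 [PDF 19] (66): «We obtain a bound of the form (41) with the expression −(1/g_k²)A^η(U_k) + Σ_{j=0}^{k−1}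
  O(log g_j⁻¹)|Z_j| + O(1)|T₁^{(k)}| (66) in the exponential. To prove the inequality (5) we have to produce all small
  factors connected with large fields regions P in the functions ζ_{Λ_j}.» … pp. 273–274 [PDF 19–20]: «We get these small
  factors for all plaquettes in all large fields set P. … The analysis of Sect. 3.C [9], which is model independent, show
  that these small factors are enough to control all sums in (41), together with the second term in (65) ⟦sic: (66)⟧.
  This gives the upper bound in (5).»  ([9] = [Balaban1982Higgs2]; its Sect. 3.C (3.43)–(3.50) counts the volume of the
  complement of the small-field region by the NUMBER of large-field points — the cell's `…B2Eq350CorridorCover`,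
  `…B2Eq350TowerVolume` for the (Higgs)₂,₃ regions.)

## Why this file exists (the located missing estimate)

The DAG node N08 has the in-edges B5–B9, B11 only (`Dag.B10_main`): everything [Balaban1985UV3] imports from the Higgs papers
[8]–[10] «as method» has to be PROVED for the node.  The first such import in the printed proof is the large-field
neighbourhood control of p. 258 («as in [9]»), i.e. the k = 0 instance of the pp. 273–274 sentence above.  The cell's kernel
closure of that sentence, `…B10LargeFieldSum.largeFieldControl_of_resummation_gRun` (pub-balaban GAPS C-B10-7 / G-B10-09),
takes three verbatim leaves over the abstract history carrier `HistModel`: the small factors `SmallFactorsAll` (geometry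
proved on the torus by `…B10Eq71TorusOverlap`, c₁ = ¼), the rate `ZtermRate` (a binding), and the COUNTED COLLAR COVER
`ZvolCover` — «|Z_j| ≤ Σ over the large-field plaquettes (i, p′), i ≤ j, of (c_g·R₁M₁·x(g_i)^{r₀})³» — whose set-theoretic
half is the abstract `…B10LargeFieldSum.cover_chain` over a schematic pseudometric carrier `CollarChain` and whose COUNT
(«the count of Lʲη-lattice points in a ball is not modelled», cell DIVERGENCE D-b10.7; GAPS G-B10-10) had NO instance on
print's own torus rule.  This module supplies it.

## What this file proves (kernel, 0 sorry, axioms standard; `P : Params` of `Setup`, any dimension `d = P.d`)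

* §1 `tdist_le_of_cubeIdx_eq`, `tdist_le_blockDist_add(')`: two sites of one big block (cube of side `s`, the cell's
  `B3Ineq314Cubes.cubeIdx`) are at ℓ¹ torus distance `≤ d(s − 1)`; hence `|x − y| ≤ blockDist_s(x, y) + 2d(s − 1)` for the
  block distance of `…B10Eq38TorusDomains` — the «block granularity» constant of the collar widths.
* §2 `ball`, `card_ball_le`: a torus ball `{y : |x − y|₁ ≤ r}` of `Site P n` has at most `(2r + 1)^d` sites (coordinatewise
  injection into the residues at circular distance `≤ r`, `B3TorusRadialSums.card_cdist_le_le`) — the lattice ball count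
  of D-b10.7.
* §3 `collarChain`: THE INSTANCE of `B10LargeFieldSum.CollarChain` for the torus rule WITH BODY `B10Eq38TorusDomains.omegaSeq`
  (maximal reading `rule268Max_ruleSeq`, `Ω₀ = T_η`, large-field point sets `F j`), with `d = |· − ·|₁` (`tdist`, triangle
  inequality `B3Taylor310LocalRemainder.tdist_triangle`) and the width `w_j = (R(g_j) + 2d)·M₁·Lʲ` fine steps
  (`lt_bdist_of_width_lt`: a site more than `w_j` steps from `P_j ∪ Ω_jᶜ` has its block more than `R(g_j)M₁` scaled block
  units away, hence belongs to `Ω_{j+1}`); whence BY NAME from `cover_chain`: **every site of `Z_j = Ω_{j+1}ᶜ` lies within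
  `Σ_{m=i}^{j} w_m` steps of a point of some `P_i`, `i ≤ j`** (`exists_source_of_mem_Z`; for print's site-to-block letter
  of the rule, `ruleSeqPt`, through `B10Eq38TorusDomains.Z_ruleSeqPt_subset`: `exists_source_of_mem_Z_pt`).
* §4 `ncard_Z_le`: **`|Z_j|_{fine sites} ≤ Σ_{i≤j} |P_i|·(2ρ_{ij} + 1)^d`**, `ρ_{ij} = Σ_{m=i}^{j} w_m` (`radius`), for every
  nonnegative collar sequence `R` and `M₁ ≥ 1` (and `ncard_Z_pt_le`).
* §5 `radius_le_of_antitone`, `ballFactor_le_of_antitone`: for collars SHRINKING along the scales (`R_m ≤ R_i`, `i ≤ m`) the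
  accumulated width is `≤ (R_i + 2d)M₁Lʲ⁺¹/(L − 1)` (cell GAPS G-adv2-7: «the neighbourhoods accumulate to ≤ RM₁L/(L−1) in
  scale-j units»), so that in the units of the `Lʲη`-lattice the ball factor is `(Lʲ)^d·c_g(R_i)^d`,
  `c_g(R) = 2(R + 2d)M₁L/(L − 1) + 1` (`cgeo`).
* §6 `ncard_Z_le_units`, `ncard_Z_le_flow`: along the PRINTED collars `R(g_j) = R₁r(g_j) = R₁x(g_j)^{r₀}`
  (`B10Eq38TorusDomains.collarPrinted`, `x(g) = 1 + log g⁻¹ = B10LargeField.xlog`), which shrink along every non-decreasing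
  coupling sequence `0 < g_j ≤ 1` (`collarPrinted_antitone`; d = 3: `g_j = g(Lʲε)^{1/2}` grows, p. 256), with `r₀ ≥ 0`,
  `R₁ ≥ 0`: **`|Z_j|_{fine} ≤ (Lʲ)^d Σ_{i≤j} |P_i| (c_g(R₁)·x(g_i)^{r₀})^d`**.
* §7 `ncard_cornerPts_le`, `ncard_Z_le_plaquettes` (+ `_pt`): with `P_i` = the corner points of the large-field PLAQUETTES
  `S_i` of the passage `i → i+1` (`B10Eq38TorusDomains.cornerPts`, ≤ 4 points each):
  **`|Z_j|_{fine} ≤ (Lʲ)^d Σ_{i≤j} 4|S_i| (c_g(R₁)·x(g_i)^{r₀})^d`**, i.e. — dividing by the `(Lʲ)^d` fine sites of a unit cell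
  of the `Lʲη`-lattice («Here the sets Z_j are rescaled to the unit scale») — at d = 3 exactly the summand shape
  `(c_g ρ)³·x(g_i)^{3r₀}` per large-field plaquette of the leaf `B10LargeFieldSum.ZvolCover` (`flow_summand_eq`), with the
  geometric constant DISPLAYED: `c_g ρ = 2(R₁ + 2d)M₁L/(L − 1) + 1` (times `4^{1/3}` for the four corners).

## What is NOT claimed

(i) The abstract leaf `ZvolCover X cg ρ r₀` itself is a statement about a `HistModel` over `B10.TowerRun` (the functional
`LF` of (41), its histories and `zvol`); no `HistModel` is constructed here — this file proves the geometric inequality the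
field `zvol` must satisfy once it is instantiated by the fine-site count of `Z_j` on the torus (divided by `L^{jd}`).
(ii) The rule is read maximally («THE union of the big blocks with distances … greater than R(g_k)M₁»), as in
`B10LargeField.Rule268Max` / `B10LargeFieldSum.CollarChain.ruleMax`; for a non-maximal choice of admissible blocks no volume
bound in terms of `P` alone can hold.  (iii) «dist» is the ℓ¹ torus distance in fine lattice steps (cell DIVERGENCE F2); the
widths carry the honest granularity `2d·M₁Lʲ` of the block-to-block distance.  (iv) `Ω₀ = T_η` (the convention «Λ₀ = Ω₁ᶜ»
of (42)); `M₁ ≥ 1`; `d = P.d` free (print: d = 3).  (v) No exponent bookkeeping (`3r₀ + 2 ≤ 2p₀`, G-B10-02) is touched: that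
is `B10LargeFieldSum.largeFieldControl_of_resummation`'s business.

Cell records: pub-balaban GAPS G-B10-02 / G-adv2-7 / G-B10-09 (the {Ω_j}-summation), C-B10-7 (kernel closure modulo leaves),
G-B10-10 (b)–(c) (unprinted geometric inputs), DIVERGENCE D-b10.7 (ball count not modelled), F2 (ℓ¹ distance); SKELETON rows
B10.Eq39, B10.Eq41, B10.Eq71 (lit-balaban); YM-PLAN §2b N08.
-/

noncomputable section

namespace Literature.MathematicalPhysics.QuantumFieldTheory.Balaban1983to89.B10Eq39CollarVolume

open Literature.MathematicalPhysics.QuantumFieldTheory.Balaban1983to89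
open Literature.MathematicalPhysics.QuantumFieldTheory.Balaban1983to89.B3Ineq314Cubes (cubeIdx cdist)
open Literature.MathematicalPhysics.QuantumFieldTheory.Balaban1983to89.B10LargeField (DomainSeq Z xlog rFun_eq
  one_le_xlog)
open Literature.MathematicalPhysics.QuantumFieldTheory.Balaban1983to89.B10LargeFieldSum (CollarChain cover_chain)
open Literature.MathematicalPhysics.QuantumFieldTheory.Balaban1983to89.B10Eq38TorusDomains
open Literature.MathematicalPhysics.QuantumFieldTheory.Balaban1983to89.B3Taylor310LocalRemainder (tdist_triangle
  tdist_comm)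

variable {P : Params}

/-! ## §1 The ℓ¹ diameter of a big block and the block distance versus the site distance -/

section Blocks

variable {n : ℕ}

/-- Two naturals with the same quotient by `s ≥ 1` differ by at most `s − 1`. [folklore] -/
private theorem le_add_of_div_eq {s a b : ℕ} (hs : 0 < s) (h : a / s = b / s) : a ≤ b + (s - 1) := by
  have ha := Nat.div_add_mod a s
  have hb := Nat.div_add_mod b s
  have hma := Nat.mod_lt a hs
  have hmb := Nat.mod_lt b hs
  rw [h] at ha
  omega

/-- The circular distance of two residues is at most the distance of their representatives. [folklore] -/
private theorem min_val_sub_le {N : ℕ} [NeZero N] (a b : ZMod N) {t : ℕ} (h1 : a.val ≤ b.val + t)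
    (h2 : b.val ≤ a.val + t) : min (a - b).val (b - a).val ≤ t := by
  rcases le_total b.val a.val with hle | hle
  · have := ZMod.val_sub hle
    have : (a - b).val ≤ t := by rw [this]; omega
    exact (min_le_left _ _).trans this
  · have := ZMod.val_sub hle
    have : (b - a).val ≤ t := by rw [this]; omega
    exact (min_le_right _ _).trans this

/-- **The ℓ¹ diameter of a big block** («Ω_j is a union of big blocks of the size M₁Lʲη», (39) p. 266): two sites of the fine
torus in the same cube of side `s` (`cubeIdx s`) are at most `d(s − 1)` lattice steps apart. [cite: Balaban1985UV3, (39) p.266] -/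
theorem tdist_le_of_cubeIdx_eq {s : ℕ} (hs : 0 < s) {x x' : Site P n} (h : cubeIdx s x = cubeIdx s x') :
    Site.tdist x x' ≤ P.d * (s - 1) := by
  unfold Site.tdist
  calc ∑ μ : Fin P.d, min (x μ - x' μ).val (x' μ - x μ).val ≤ ∑ _μ : Fin P.d, (s - 1) := by
        refine Finset.sum_le_sum fun μ _ => ?_
        have hμ : (x μ).val / s = (x' μ).val / s := congrFun h μ
        exact min_val_sub_le (x μ) (x' μ) (le_add_of_div_eq hs hμ) (le_add_of_div_eq hs hμ.symm)
    _ = P.d * (s - 1) := by rw [Finset.sum_const, Finset.card_univ, Fintype.card_fin, smul_eq_mul]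

/-- **Block distance versus site distance** («(Lʲη)⁻¹dist(Ω_jᶜ, Ω_{j+1})» between unions of big blocks, (39) p. 266): the site
distance exceeds the block distance of `…B10Eq38TorusDomains` (`blockDist`, attained at two sites of the two blocks) by at most
two block diameters, `|x − y|₁ ≤ blockDist_s(x, y) + 2d(s − 1)`. [cite: Balaban1985UV3, (39) p.266] -/
theorem tdist_le_blockDist_add {s : ℕ} (hs : 0 < s) (x y : Site P n) :
    Site.tdist x y ≤ blockDist P n s x y + 2 * (P.d * (s - 1)) := by
  obtain ⟨x', y', hx', hy', hd⟩ := blockDist_attained (P := P) s x y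
  have h1 : Site.tdist x x' ≤ P.d * (s - 1) := tdist_le_of_cubeIdx_eq hs hx'.symm
  have h2 : Site.tdist y' y ≤ P.d * (s - 1) := tdist_le_of_cubeIdx_eq hs hy'
  have t1 := tdist_triangle x x' y
  have t2 := tdist_triangle x' y' y
  omega

/-- The same with the granularity rounded up to `2d·s` (no truncated subtraction). [cite: Balaban1985UV3, (39) p.266] -/
theorem tdist_le_blockDist_add' {s : ℕ} (hs : 0 < s) (x y : Site P n) :
    Site.tdist x y ≤ blockDist P n s x y + 2 * (P.d * s) := by
  have h := tdist_le_blockDist_add hs x y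
  have : P.d * (s - 1) ≤ P.d * s := Nat.mul_le_mul_left _ (Nat.sub_le s 1)
  omega

end Blocks

/-! ## §2 Counting the sites of a torus ball -/

section Ball

variable {n : ℕ}

/-- «a neighbourhood of the plaquette p, for example a neighbourhood of the radius RM₁» (p. 258): the ℓ¹ torus ball of radius
`r` lattice steps around a site, as a finite set. [cite: Balaban1985UV3, p.258] -/
def ball (x : Site P n) (r : ℕ) : Finset (Site P n) := Finset.univ.filter fun y => Site.tdist x y ≤ r

/-- Membership in the ball, unfolded. [cite: Balaban1985UV3, p.258] -/
@[simp] theorem mem_ball {x y : Site P n} {r : ℕ} : y ∈ ball x r ↔ Site.tdist x y ≤ r := by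
  simp [ball]

/-- **The lattice ball count** (the input «not modelled» in cell DIVERGENCE D-b10.7): an ℓ¹ ball of radius `r` of the torus
`Site P n` has at most `(2r + 1)^d` sites — `y ↦ (y_μ − x_μ)_μ` injects it into the product of the sets of residues at circular
distance `≤ r`, each of cardinality `≤ 2r + 1` (`B3TorusRadialSums.card_cdist_le_le`). [cite: Balaban1985UV3, p.258] -/
theorem card_ball_le (x : Site P n) (r : ℕ) : (ball x r).card ≤ (2 * r + 1) ^ P.d := by
  classical
  let g : Site P n → (Fin P.d → ZMod (P.sitesPerDir n)) := fun y μ => y μ - x μ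
  have hmaps : ∀ y ∈ ball x r,
      g y ∈ Fintype.piFinset fun _ : Fin P.d =>
        (Finset.univ.filter fun m : ZMod (P.sitesPerDir n) => B3TorusRadialSums.cdist m ≤ r) := by
    intro y hy
    rw [mem_ball, B3TorusRadialSums.tdist_eq_sum_cdist] at hy
    refine Fintype.mem_piFinset.mpr fun μ => Finset.mem_filter.mpr ⟨Finset.mem_univ _, ?_⟩
    have hle : B3TorusRadialSums.cdist (x μ - y μ) ≤ r :=
      le_trans (Finset.single_le_sum (f := fun μ => B3TorusRadialSums.cdist (x μ - y μ))
        (fun _ _ => Nat.zero_le _) (Finset.mem_univ μ)) hy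
    have : g y μ = -(x μ - y μ) := by simp [g]
    rw [this, B3TorusRadialSums.cdist_neg]
    exact hle
  have hinj : Set.InjOn g (ball x r) := by
    intro y _ y' _ hyy'
    funext μ
    have := congrFun hyy' μ
    simpa [g] using this
  calc (ball x r).card
      ≤ (Fintype.piFinset fun _ : Fin P.d =>
          (Finset.univ.filter fun m : ZMod (P.sitesPerDir n) => B3TorusRadialSums.cdist m ≤ r)).card :=
        Finset.card_le_card_of_injOn g hmaps hinj
    _ ≤ (2 * r + 1) ^ P.d := by
        rw [Fintype.card_piFinset, Finset.prod_const, Finset.card_univ, Fintype.card_fin]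
        exact Nat.pow_le_pow_left (B3TorusRadialSums.card_cdist_le_le r) _

/-- The ball count at a real radius `ρ ≥ 0` (radius `⌊ρ⌋` steps): `≤ (2ρ + 1)^d`. [cite: Balaban1985UV3, p.258] -/
theorem card_ball_floor_le (x : Site P n) {ρ : ℝ} (hρ : 0 ≤ ρ) :
    ((ball x ⌊ρ⌋₊).card : ℝ) ≤ (2 * ρ + 1) ^ P.d := by
  have hc := card_ball_le x ⌊ρ⌋₊
  have hfl : (⌊ρ⌋₊ : ℝ) ≤ ρ := Nat.floor_le hρ
  calc ((ball x ⌊ρ⌋₊).card : ℝ) ≤ ((2 * ⌊ρ⌋₊ + 1 : ℕ) : ℝ) ^ P.d := by exact_mod_cast hc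
    _ ≤ (2 * ρ + 1) ^ P.d := by
        push_cast
        exact pow_le_pow_left₀ (by positivity) (by linarith) _

end Ball

/-! ## §3 The `CollarChain` of the torus rule -/

section Chain

variable (P) in
/-- **The collar width of the passage `m → m+1` in fine lattice steps**, block granularity included: `w_m = (R(g_m) + 2d)·M₁·Lᵐ`
(the rule's «distances … greater than R(g_k)M₁», p. 268, in units of the `Lᵐη`-lattice, plus two ℓ¹ block diameters, §1).
[cite: Balaban1985UV3, (39) p.266; p.268] -/
def width (M₁ : ℕ) (R : ℕ → ℝ) (m : ℕ) : ℝ := (R m + 2 * P.d) * M₁ * (P.L : ℝ) ^ m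

variable (P) in
/-- **The accumulated collar width** `ρ_{ij} = Σ_{m=i}^{j} w_m` of a scale-`i` source seen at scale `j` (cell GAPS G-adv2-7: a
scale-i large plaquette forces collars at every later scale). [cite: Balaban1985UV3, (39) p.266; pp.267–268] -/
def radius (M₁ : ℕ) (R : ℕ → ℝ) (i j : ℕ) : ℝ := ∑ m ∈ Finset.Icc i j, width P M₁ R m

/-- `w_m ≥ 0` for `R(g_m) ≥ 0`. [cite: Balaban1985UV3, (39) p.266] -/
theorem width_nonneg {M₁ : ℕ} {R : ℕ → ℝ} {m : ℕ} (hR : 0 ≤ R m) : 0 ≤ width P M₁ R m := by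
  unfold width
  positivity

/-- `ρ_{ij} ≥ 0` for a nonnegative collar sequence. [cite: Balaban1985UV3, (39) p.266] -/
theorem radius_nonneg {M₁ : ℕ} {R : ℕ → ℝ} (hR : ∀ m, 0 ≤ R m) (i j : ℕ) : 0 ≤ radius P M₁ R i j :=
  Finset.sum_nonneg fun m _ => width_nonneg (hR m)

/-- **The one-step implication behind the chain** (p. 268 rule, maximal reading): if a site `y` is more than `w_j` fine steps
from `x`, then the scale-`j` big block of `y` is more than `R(g_j)M₁` scaled block units (`B10Eq38TorusDomains.bdist`) from that
of `x` — by §1, `|x − y|₁ ≤ Lʲ·bdist_j(x, y) + 2dM₁Lʲ`.  Needs `M₁ ≥ 1`. [cite: Balaban1985UV3, p.268; (39) p.266] -/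
theorem lt_bdist_of_width_lt {M₁ : ℕ} (hM : 0 < M₁) {R : ℕ → ℝ} {j : ℕ} {x y : Site P 0}
    (h : width P M₁ R j < (Site.tdist x y : ℝ)) : R j * M₁ < bdist P M₁ j x y := by
  have hL : 0 < P.L := P.L_pos
  have hs : 0 < M₁ * P.L ^ j := Nat.mul_pos hM (pow_pos hL j)
  have hLj : (0 : ℝ) < (P.L : ℝ) ^ j := by positivity
  have hgeo : (Site.tdist x y : ℝ) ≤
      (blockDist P 0 (M₁ * P.L ^ j) x y : ℝ) + 2 * ((P.d : ℝ) * ((M₁ : ℝ) * (P.L : ℝ) ^ j)) := by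
    have := tdist_le_blockDist_add' hs x y
    exact_mod_cast this
  unfold bdist
  rw [lt_div_iff₀ hLj]
  have h' : R j * M₁ * (P.L : ℝ) ^ j + 2 * ((P.d : ℝ) * ((M₁ : ℝ) * (P.L : ℝ) ^ j)) < (Site.tdist x y : ℝ) := by
    calc R j * M₁ * (P.L : ℝ) ^ j + 2 * ((P.d : ℝ) * ((M₁ : ℝ) * (P.L : ℝ) ^ j))
        = width P M₁ R j := by unfold width; ring
      _ < (Site.tdist x y : ℝ) := h
  linarith

variable (P) in
/-- **THE TORUS INSTANCE of the cell's schematic carrier `B10LargeFieldSum.CollarChain`**: points = the fine torus `T_η =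
Site P 0`; `d = |· − ·|₁` (ℓ¹ torus distance, triangle inequality `B3Taylor310LocalRemainder.tdist_triangle`); `Ω j` = the rule's
sequence WITH BODY `B10Eq38TorusDomains.omegaSeq` from `Ω₀ = T_η` («Λ₀ = Ω₁ᶜ», (42) p. 266) and the large-field point sets `F j`;
`w = width`; `ruleMax` = the maximal reading «THE union of the big blocks with distances to P ∪ Ω_k^{(k)c} greater than
R(g_k)M₁» (p. 268; `B10Eq38TorusDomains.rule268Max_ruleSeq`) transported through `lt_bdist_of_width_lt`.
[cite: Balaban1985UV3, p.268; (38)–(39) p.266; p.257] -/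
def collarChain (M₁ : ℕ) (hM : 0 < M₁) (R : ℕ → ℝ) (F : ℕ → Set (Site P 0)) : CollarChain where
  Pt := Site P 0
  d := fun x y => (Site.tdist x y : ℝ)
  d_triangle := fun x y z => by exact_mod_cast tdist_triangle x y z
  Ω := omegaSeq P M₁ R Set.univ F
  P := F
  w := width P M₁ R
  Ω_zero := fun x => Set.mem_univ x
  ruleMax := fun j y hy => by
    rw [omegaSeq_succ]
    exact fun x hx => lt_bdist_of_width_lt hM (hy x hx)

/-- «we denote Z_j = Ω_{j+1}^{(j)c}» (p. 266): `Z_j` of the torus rule sequence `ruleSeq` is the complement of `Ω_{j+1}` in `T_η`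
(definitional). [cite: Balaban1985UV3, p.266] -/
theorem Z_ruleSeq_eq (M₁ : ℕ) (R : ℕ → ℝ) (Ω₀ : Set (Site P 0)) (F : ℕ → Set (Site P 0)) (j : ℕ) :
    Z (ruleSeq P M₁ R Ω₀ F) j = (omegaSeq P M₁ R Ω₀ F (j + 1))ᶜ := rfl

/-- The same for print's site-to-block letter of the rule (`ruleSeqPt`). [cite: Balaban1985UV3, p.268; p.266] -/
theorem Z_ruleSeqPt_eq (M₁ : ℕ) (R : ℕ → ℝ) (Ω₀ : Set (Site P 0)) (F : ℕ → Set (Site P 0)) (j : ℕ) :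
    Z (ruleSeqPt P M₁ R Ω₀ F) j = (omegaSeqPt P M₁ R Ω₀ F (j + 1))ᶜ := rfl

/-- **THE COLLAR COVER ON THE TORUS** («This small factor controls the part of the integral over a neighbourhood of the
plaquette p, for example a neighbourhood of the radius RM₁, as in [9]», p. 258; the {Ω_j}-chain of pp. 266–268): every site
outside `Ω_{j+1}` lies within `ρ_{ij} = Σ_{m=i}^{j} (R(g_m) + 2d)M₁Lᵐ` fine steps of a large-field point of some scale `i ≤ j` —
`B10LargeFieldSum.cover_chain` BY NAME at the instance `collarChain`. [cite: Balaban1985UV3, p.258; (39) p.266; p.268] -/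
theorem exists_source_of_not_mem_omegaSeq {M₁ : ℕ} (hM : 0 < M₁) (R : ℕ → ℝ) (F : ℕ → Set (Site P 0)) {j : ℕ}
    {y : Site P 0} (hy : y ∉ omegaSeq P M₁ R Set.univ F (j + 1)) :
    ∃ i, i ≤ j ∧ ∃ x, x ∈ F i ∧ (Site.tdist x y : ℝ) ≤ radius P M₁ R i j :=
  cover_chain (collarChain P M₁ hM R F) j y hy

/-- The cover stated for `Z_j` of the cell's record `B10LargeField.Z (ruleSeq …) j` («Z_j = Ω_{j+1}^{(j)c}», p. 266).
[cite: Balaban1985UV3, p.266; p.268] -/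
theorem exists_source_of_mem_Z {M₁ : ℕ} (hM : 0 < M₁) (R : ℕ → ℝ) (F : ℕ → Set (Site P 0)) {j : ℕ}
    {y : Site P 0} (hy : y ∈ Z (ruleSeq P M₁ R Set.univ F) j) :
    ∃ i, i ≤ j ∧ ∃ x, x ∈ F i ∧ (Site.tdist x y : ℝ) ≤ radius P M₁ R i j :=
  exists_source_of_not_mem_omegaSeq hM R F hy

/-- The cover for print's site-to-block letter of the rule (`ruleSeqPt`, «distances to P ∪ Ω_k^{(k)c}» of a BLOCK, p. 268): its
`Z_j` lies inside the block-to-block one (`B10Eq38TorusDomains.Z_ruleSeqPt_subset`). [cite: Balaban1985UV3, p.268] -/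
theorem exists_source_of_mem_Z_pt {M₁ : ℕ} (hM : 0 < M₁) (R : ℕ → ℝ) (F : ℕ → Set (Site P 0)) {j : ℕ}
    {y : Site P 0} (hy : y ∈ Z (ruleSeqPt P M₁ R Set.univ F) j) :
    ∃ i, i ≤ j ∧ ∃ x, x ∈ F i ∧ (Site.tdist x y : ℝ) ≤ radius P M₁ R i j :=
  exists_source_of_mem_Z hM R F (Z_ruleSeqPt_subset M₁ R Set.univ F j hy)

end Chain

/-! ## §4 The volume count -/

section Count

open scoped Classical

/-- The covering family: the union over the scales `i ≤ j` and the large-field points `x ∈ P_i` of the torus balls of radius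
`⌊ρ_{ij}⌋` around `x` («a neighbourhood of the radius RM₁» accumulated over the scales; [9] Sect. 3.C's families 𝒟_k).
[cite: Balaban1985UV3, p.258; pp.273–274] -/
def cover (M₁ : ℕ) (R : ℕ → ℝ) (F : ℕ → Set (Site P 0)) (j : ℕ) : Finset (Site P 0) :=
  (Finset.range (j + 1)).biUnion fun i =>
    (Set.toFinite (F i)).toFinset.biUnion fun x => ball x ⌊radius P M₁ R i j⌋₊

/-- `Ω_{j+1}ᶜ` is contained in the covering family (from the cover theorem). [cite: Balaban1985UV3, p.258; pp.273–274] -/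
theorem compl_omegaSeq_subset_cover {M₁ : ℕ} (hM : 0 < M₁) (R : ℕ → ℝ) (F : ℕ → Set (Site P 0)) (j : ℕ) :
    (omegaSeq P M₁ R Set.univ F (j + 1))ᶜ ⊆ ↑(cover M₁ R F j) := by
  intro y hy
  obtain ⟨i, hij, x, hx, hd⟩ := exists_source_of_not_mem_omegaSeq hM R F hy
  refine Finset.mem_coe.mpr (Finset.mem_biUnion.mpr ⟨i, Finset.mem_range.mpr (by omega),
    Finset.mem_biUnion.mpr ⟨x, ?_, ?_⟩⟩)
  · exact (Set.toFinite (F i)).mem_toFinset.mpr hx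
  · exact mem_ball.mpr (Nat.le_floor hd)

/-- The covering family has at most `Σ_{i≤j} |P_i|·(2ρ_{ij} + 1)^d` sites (union bound and the ball count §2).
[cite: Balaban1985UV3, p.258; pp.273–274] -/
theorem card_cover_le {M₁ : ℕ} {R : ℕ → ℝ} (hR : ∀ m, 0 ≤ R m) (F : ℕ → Set (Site P 0)) (j : ℕ) :
    ((cover M₁ R F j).card : ℝ) ≤
      ∑ i ∈ Finset.range (j + 1), ((F i).ncard : ℝ) * (2 * radius P M₁ R i j + 1) ^ P.d := by
  unfold cover
  have h1 : (((Finset.range (j + 1)).biUnion fun i =>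
      (Set.toFinite (F i)).toFinset.biUnion fun x => ball x ⌊radius P M₁ R i j⌋₊).card : ℝ)
      ≤ ∑ i ∈ Finset.range (j + 1), ∑ x ∈ (Set.toFinite (F i)).toFinset,
          ((ball x ⌊radius P M₁ R i j⌋₊).card : ℝ) := by
    have h2 := (Finset.card_biUnion_le (s := Finset.range (j + 1))
      (t := fun i => (Set.toFinite (F i)).toFinset.biUnion fun x => ball x ⌊radius P M₁ R i j⌋₊))
    have h3 : ∑ i ∈ Finset.range (j + 1),
        ((Set.toFinite (F i)).toFinset.biUnion fun x => ball x ⌊radius P M₁ R i j⌋₊).card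
        ≤ ∑ i ∈ Finset.range (j + 1), ∑ x ∈ (Set.toFinite (F i)).toFinset,
            (ball x ⌊radius P M₁ R i j⌋₊).card :=
      Finset.sum_le_sum fun i _ => Finset.card_biUnion_le
    exact_mod_cast h2.trans h3
  refine h1.trans (Finset.sum_le_sum fun i _ => ?_)
  have hρ : 0 ≤ radius P M₁ R i j := radius_nonneg hR i j
  calc ∑ x ∈ (Set.toFinite (F i)).toFinset, ((ball x ⌊radius P M₁ R i j⌋₊).card : ℝ)
      ≤ ∑ _x ∈ (Set.toFinite (F i)).toFinset, (2 * radius P M₁ R i j + 1) ^ P.d :=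
        Finset.sum_le_sum fun x _ => card_ball_floor_le x hρ
    _ = ((F i).ncard : ℝ) * (2 * radius P M₁ R i j + 1) ^ P.d := by
        rw [Finset.sum_const, nsmul_eq_mul, ← Set.ncard_eq_toFinset_card (F i) (Set.toFinite (F i))]

/-- **THE COLLAR VOLUME COUNT, fine sites**: for every nonnegative collar sequence `R` and `M₁ ≥ 1`,
`|Z_j| ≤ Σ_{i≤j} |P_i|·(2ρ_{ij} + 1)^d` — the volume of the history's `Z_j` («+ Σ_{j=0}^{k−1} O(log g_j⁻¹)|Z_j|», (41)/(66)) is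
controlled by the NUMBERS of large-field points of the scales `≤ j` ([9] Sect. 3.C (3.50), «model independent»).
[cite: Balaban1985UV3, (41) p.266; (66) p.273; pp.273–274] -/
theorem ncard_Z_le {M₁ : ℕ} (hM : 0 < M₁) {R : ℕ → ℝ} (hR : ∀ m, 0 ≤ R m) (F : ℕ → Set (Site P 0))
    (j : ℕ) :
    ((Z (ruleSeq P M₁ R Set.univ F) j).ncard : ℝ) ≤
      ∑ i ∈ Finset.range (j + 1), ((F i).ncard : ℝ) * (2 * radius P M₁ R i j + 1) ^ P.d := by
  rw [Z_ruleSeq_eq]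
  have hsub := compl_omegaSeq_subset_cover hM R F j
  have h1 : ((omegaSeq P M₁ R Set.univ F (j + 1))ᶜ).ncard ≤ (cover M₁ R F j).card := by
    have := Set.ncard_le_ncard hsub (Finset.finite_toSet _)
    rwa [Set.ncard_coe_finset] at this
  exact le_trans (by exact_mod_cast h1) (card_cover_le hR F j)

/-- The fine-site count for print's site-to-block letter of the rule (`ruleSeqPt`). [cite: Balaban1985UV3, p.268; (41) p.266] -/
theorem ncard_Z_pt_le {M₁ : ℕ} (hM : 0 < M₁) {R : ℕ → ℝ} (hR : ∀ m, 0 ≤ R m) (F : ℕ → Set (Site P 0))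
    (j : ℕ) :
    ((Z (ruleSeqPt P M₁ R Set.univ F) j).ncard : ℝ) ≤
      ∑ i ∈ Finset.range (j + 1), ((F i).ncard : ℝ) * (2 * radius P M₁ R i j + 1) ^ P.d := by
  refine le_trans ?_ (ncard_Z_le hM hR F j)
  have hfin : (Z (ruleSeq P M₁ R Set.univ F) j).Finite := by
    show ((omegaSeq P M₁ R Set.univ F (j + 1))ᶜ : Set (Site P 0)).Finite
    exact Set.toFinite _
  have := Set.ncard_le_ncard (Z_ruleSeqPt_subset M₁ R Set.univ F j) hfin
  exact_mod_cast this

end Count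

/-! ## §5 The count in the units of the `Lʲη`-lattice and along a flow with shrinking collars -/

section Units

/-- `Σ_{m=i}^{j} Lᵐ ≤ Lʲ⁺¹/(L − 1)` for `L > 1`. [folklore] -/
private theorem sum_Icc_pow_le {L : ℝ} (hL : 1 < L) (i j : ℕ) :
    ∑ m ∈ Finset.Icc i j, L ^ m ≤ L ^ (j + 1) / (L - 1) := by
  have hL1 : 0 < L - 1 := by linarith
  have hsub : Finset.Icc i j ⊆ Finset.range (j + 1) := by
    intro m hm
    rw [Finset.mem_Icc] at hm
    exact Finset.mem_range.mpr (by omega)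
  calc ∑ m ∈ Finset.Icc i j, L ^ m ≤ ∑ m ∈ Finset.range (j + 1), L ^ m :=
        Finset.sum_le_sum_of_subset_of_nonneg hsub fun m _ _ => by positivity
    _ = (L ^ (j + 1) - 1) / (L - 1) := geom_sum_eq (by linarith) (j + 1)
    _ ≤ L ^ (j + 1) / (L - 1) := div_le_div_of_nonneg_right (by linarith) hL1.le

/-- **Accumulated widths for shrinking collars** (cell GAPS G-adv2-7: «the neighbourhoods accumulate to ≤ RM₁L/(L−1) in scale-j
units»): if `R(g_m) ≤ R(g_i)` for `i ≤ m ≤ j` and `R(g_i) ≥ 0`, then `ρ_{ij} ≤ (R(g_i) + 2d)·M₁·Lʲ⁺¹/(L − 1)`.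
[cite: Balaban1985UV3, (39) p.266; p.268] -/
theorem radius_le_of_antitone {M₁ : ℕ} {R : ℕ → ℝ} {i j : ℕ} (hRi : 0 ≤ R i)
    (hmono : ∀ m, i ≤ m → m ≤ j → R m ≤ R i) :
    radius P M₁ R i j ≤ (R i + 2 * P.d) * M₁ * ((P.L : ℝ) ^ (j + 1) / ((P.L : ℝ) - 1)) := by
  have hL : (1 : ℝ) < (P.L : ℝ) := by exact_mod_cast P.hL.2
  unfold radius width
  have hc : 0 ≤ (R i + 2 * P.d) * M₁ := by positivity
  calc ∑ m ∈ Finset.Icc i j, (R m + 2 * P.d) * M₁ * (P.L : ℝ) ^ m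
      ≤ ∑ m ∈ Finset.Icc i j, (R i + 2 * P.d) * M₁ * (P.L : ℝ) ^ m := by
        refine Finset.sum_le_sum fun m hm => ?_
        rw [Finset.mem_Icc] at hm
        have h1 : R m ≤ R i := hmono m hm.1 hm.2
        have h2 : (0 : ℝ) ≤ (P.L : ℝ) ^ m := by positivity
        have h3 : (R m + 2 * P.d) * M₁ ≤ (R i + 2 * P.d) * M₁ :=
          mul_le_mul_of_nonneg_right (by linarith) (Nat.cast_nonneg _)
        exact mul_le_mul_of_nonneg_right h3 h2
    _ = (R i + 2 * P.d) * M₁ * ∑ m ∈ Finset.Icc i j, (P.L : ℝ) ^ m := by rw [Finset.mul_sum]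
    _ ≤ (R i + 2 * P.d) * M₁ * ((P.L : ℝ) ^ (j + 1) / ((P.L : ℝ) - 1)) :=
        mul_le_mul_of_nonneg_left (sum_Icc_pow_le hL i j) hc

variable (P) in
/-- **The geometric constant of the count in `Lʲη`-units**: `c_g(R) = 2(R + 2d)·M₁·L/(L − 1) + 1` — the «c_g·ρ» of the leaf
`B10LargeFieldSum.ZvolCover` («block granularity and the factor L/(L − 1) of the accumulated widths») made explicit.
[cite: Balaban1985UV3, (39) p.266; p.268] -/
def cgeo (M₁ : ℕ) (Ri : ℝ) : ℝ := 2 * ((Ri + 2 * P.d) * M₁ * ((P.L : ℝ) / ((P.L : ℝ) - 1))) + 1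

/-- `c_g(R) ≥ 0` for `R ≥ 0` (`L ≥ 2`). [cite: Balaban1985UV3, (39) p.266] -/
theorem cgeo_nonneg {M₁ : ℕ} {Ri : ℝ} (hRi : 0 ≤ Ri) : 0 ≤ cgeo P M₁ Ri := by
  have hL : (1 : ℝ) < (P.L : ℝ) := by exact_mod_cast P.hL.2
  unfold cgeo
  have : 0 ≤ (P.L : ℝ) / ((P.L : ℝ) - 1) := div_nonneg (by linarith) (by linarith)
  positivity

/-- **The ball factor in `Lʲη`-units** («Here the sets Z_j are rescaled to the unit scale», p. 266): for shrinking nonnegative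
collars `(2ρ_{ij} + 1)^d ≤ (Lʲ)^d·c_g(R(g_i))^d`. [cite: Balaban1985UV3, (41) p.266; (39) p.266] -/
theorem ballFactor_le_of_antitone {M₁ : ℕ} {R : ℕ → ℝ} (hR : ∀ m, 0 ≤ R m) {i j : ℕ}
    (hmono : ∀ m, i ≤ m → m ≤ j → R m ≤ R i) :
    (2 * radius P M₁ R i j + 1) ^ P.d ≤ ((P.L : ℝ) ^ j) ^ P.d * cgeo P M₁ (R i) ^ P.d := by
  have hL : (1 : ℝ) < (P.L : ℝ) := by exact_mod_cast P.hL.2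
  have hLj : (1 : ℝ) ≤ (P.L : ℝ) ^ j := one_le_pow₀ hL.le
  have hrad := radius_le_of_antitone (P := P) (M₁ := M₁) (hR i) hmono
  have hρ : 0 ≤ radius P M₁ R i j := radius_nonneg hR i j
  rw [← mul_pow]
  refine pow_le_pow_left₀ (by linarith) ?_ _
  have hA : 0 ≤ (R i + 2 * P.d) * M₁ * ((P.L : ℝ) / ((P.L : ℝ) - 1)) := by
    have : 0 ≤ (P.L : ℝ) / ((P.L : ℝ) - 1) := div_nonneg (by linarith) (by linarith)
    have := hR i
    positivity
  have key : radius P M₁ R i j ≤ (P.L : ℝ) ^ j * ((R i + 2 * P.d) * M₁ * ((P.L : ℝ) / ((P.L : ℝ) - 1))) := by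
    calc radius P M₁ R i j ≤ (R i + 2 * P.d) * M₁ * ((P.L : ℝ) ^ (j + 1) / ((P.L : ℝ) - 1)) := hrad
      _ = (P.L : ℝ) ^ j * ((R i + 2 * P.d) * M₁ * ((P.L : ℝ) / ((P.L : ℝ) - 1))) := by
          rw [pow_succ]; ring
  unfold cgeo
  nlinarith [key, hLj, hA]

end Units

/-! ## §6 The count in `Lʲη` units for shrinking collars, and along the printed flow `R(g_j) = R₁r(g_j)` -/

section Flow

/-- **The count in `Lʲη`-units, shrinking collars**: `|Z_j|_{fine} ≤ (Lʲ)^d Σ_{i≤j} |P_i|·c_g(R(g_i))^d` for every antitone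
nonnegative collar sequence and `M₁ ≥ 1`. [cite: Balaban1985UV3, (41) p.266; (66) p.273; pp.273–274] -/
theorem ncard_Z_le_units {M₁ : ℕ} (hM : 0 < M₁) {R : ℕ → ℝ} (hR : ∀ m, 0 ≤ R m)
    (hanti : ∀ i m, i ≤ m → R m ≤ R i) (F : ℕ → Set (Site P 0)) (j : ℕ) :
    ((Z (ruleSeq P M₁ R Set.univ F) j).ncard : ℝ) ≤
      ((P.L : ℝ) ^ j) ^ P.d * ∑ i ∈ Finset.range (j + 1), ((F i).ncard : ℝ) * cgeo P M₁ (R i) ^ P.d := by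
  refine (ncard_Z_le hM hR F j).trans ?_
  rw [Finset.mul_sum]
  refine Finset.sum_le_sum fun i _ => ?_
  have hb := ballFactor_le_of_antitone (P := P) (M₁ := M₁) hR (i := i) (j := j) (fun m him _ => hanti i m him)
  have hF : (0 : ℝ) ≤ ((F i).ncard : ℝ) := Nat.cast_nonneg _
  calc ((F i).ncard : ℝ) * (2 * radius P M₁ R i j + 1) ^ P.d
      ≤ ((F i).ncard : ℝ) * (((P.L : ℝ) ^ j) ^ P.d * cgeo P M₁ (R i) ^ P.d) := mul_le_mul_of_nonneg_left hb hF
    _ = ((P.L : ℝ) ^ j) ^ P.d * (((F i).ncard : ℝ) * cgeo P M₁ (R i) ^ P.d) := by ring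

/-- The count in `Lʲη`-units for print's site-to-block letter of the rule. [cite: Balaban1985UV3, p.268; (41) p.266] -/
theorem ncard_Z_pt_le_units {M₁ : ℕ} (hM : 0 < M₁) {R : ℕ → ℝ} (hR : ∀ m, 0 ≤ R m)
    (hanti : ∀ i m, i ≤ m → R m ≤ R i) (F : ℕ → Set (Site P 0)) (j : ℕ) :
    ((Z (ruleSeqPt P M₁ R Set.univ F) j).ncard : ℝ) ≤
      ((P.L : ℝ) ^ j) ^ P.d * ∑ i ∈ Finset.range (j + 1), ((F i).ncard : ℝ) * cgeo P M₁ (R i) ^ P.d := by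
  refine le_trans ?_ (ncard_Z_le_units hM hR hanti F j)
  have hfin : (Z (ruleSeq P M₁ R Set.univ F) j).Finite := by
    show ((omegaSeq P M₁ R Set.univ F (j + 1))ᶜ : Set (Site P 0)).Finite
    exact Set.toFinite _
  exact_mod_cast Set.ncard_le_ncard (Z_ruleSeqPt_subset M₁ R Set.univ F j) hfin

/-- `x(g)` decreases as `g > 0` grows. [cite: Balaban1985UV3, (7) p.257] -/
theorem xlog_antitone {g g' : ℝ} (hg : 0 < g) (hgg' : g ≤ g') : xlog g' ≤ xlog g := by
  unfold xlog
  have hg' : 0 < g' := lt_of_lt_of_le hg hgg'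
  have : Real.log g'⁻¹ ≤ Real.log g⁻¹ :=
    Real.log_le_log (inv_pos.mpr hg') (inv_anti₀ hg hgg')
  linarith

/-- **The printed collar shrinks along the flow**: `R(g_j) = R₁r(g_j)` ((39) p. 266, `B10Eq38TorusDomains.collarPrinted`) is
antitone in the scale along every non-decreasing coupling sequence `0 < g_j ≤ 1` when `R₁ ≥ 0`, `r₀ ≥ 0` (d = 3: «g_k =
g(Lᵏε)^{1/2}», p. 256, grows with k). [cite: Balaban1985UV3, (39) p.266; (5) p.256] -/
theorem collarPrinted_antitone {R₁ r₀ : ℝ} (hR : 0 ≤ R₁) (hr : 0 ≤ r₀) {g : ℕ → ℝ}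
    (hg : ∀ j, 0 < g j ∧ g j ≤ 1) (hmono : Monotone g) {i m : ℕ} (him : i ≤ m) :
    collarPrinted R₁ r₀ g m ≤ collarPrinted R₁ r₀ g i := by
  unfold collarPrinted
  rw [rFun_eq, rFun_eq]
  refine mul_le_mul_of_nonneg_left ?_ hR
  have h1 : 1 ≤ xlog (g m) := one_le_xlog (hg m).1 (hg m).2
  exact Real.rpow_le_rpow (by linarith) (xlog_antitone (hg i).1 (hmono him)) hr

/-- At the printed collar the geometric constant factors through the coupling: `c_g(R₁x(g_i)^{r₀}) ≤ c_g(R₁)·x(g_i)^{r₀}`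
(`x(g_i)^{r₀} ≥ 1` for `0 < g_i ≤ 1`, `r₀ ≥ 0`; no sign condition on `R₁`). [cite: Balaban1985UV3, (39) p.266; (7) p.257] -/
theorem cgeo_collarPrinted_le {M₁ : ℕ} (R₁ : ℝ) {r₀ : ℝ} (hr : 0 ≤ r₀) {g : ℕ → ℝ}
    (hg : ∀ j, 0 < g j ∧ g j ≤ 1) (i : ℕ) :
    cgeo P M₁ (collarPrinted R₁ r₀ g i) ≤ cgeo P M₁ R₁ * xlog (g i) ^ r₀ := by
  have hL : (1 : ℝ) < (P.L : ℝ) := by exact_mod_cast P.hL.2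
  have hq : 0 ≤ (P.L : ℝ) / ((P.L : ℝ) - 1) := div_nonneg (by linarith) (by linarith)
  have hx : 1 ≤ xlog (g i) ^ r₀ := Real.one_le_rpow (one_le_xlog (hg i).1 (hg i).2) hr
  unfold cgeo collarPrinted
  rw [rFun_eq]
  have hM : (0 : ℝ) ≤ M₁ := Nat.cast_nonneg _
  have hd : (0 : ℝ) ≤ P.d := Nat.cast_nonneg _
  have hMq : 0 ≤ (M₁ : ℝ) * ((P.L : ℝ) / ((P.L : ℝ) - 1)) := mul_nonneg hM hq
  nlinarith [mul_nonneg hMq hd, mul_nonneg (mul_nonneg hMq hd) (sub_nonneg.mpr hx),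
    mul_nonneg hMq (sub_nonneg.mpr hx), sub_nonneg.mpr hx]

/-- **THE COUNT ALONG THE PRINTED FLOW**: with the collars `R(g_j) = R₁r(g_j)` of (39), `R₁ ≥ 0`, `r₀ ≥ 0`, a non-decreasing
coupling sequence `0 < g_j ≤ 1` and `M₁ ≥ 1`: `|Z_j|_{fine} ≤ (Lʲ)^d Σ_{i≤j} |P_i|·(c_g(R₁)·x(g_i)^{r₀})^d`.
[cite: Balaban1985UV3, (39) p.266; (41) p.266; (66) p.273; pp.273–274] -/
theorem ncard_Z_le_flow {M₁ : ℕ} (hM : 0 < M₁) {R₁ r₀ : ℝ} (hR : 0 ≤ R₁) (hr : 0 ≤ r₀) {g : ℕ → ℝ}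
    (hg : ∀ j, 0 < g j ∧ g j ≤ 1) (hmono : Monotone g) (F : ℕ → Set (Site P 0)) (j : ℕ) :
    ((Z (ruleSeq P M₁ (collarPrinted R₁ r₀ g) Set.univ F) j).ncard : ℝ) ≤
      ((P.L : ℝ) ^ j) ^ P.d *
        ∑ i ∈ Finset.range (j + 1), ((F i).ncard : ℝ) * (cgeo P M₁ R₁ * xlog (g i) ^ r₀) ^ P.d := by
  have hRm : ∀ m, 0 ≤ collarPrinted R₁ r₀ g m := fun m => collarPrinted_nonneg hR (hg m).1 (hg m).2
  have hanti : ∀ i m, i ≤ m → collarPrinted R₁ r₀ g m ≤ collarPrinted R₁ r₀ g i :=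
    fun i m him => collarPrinted_antitone hR hr hg hmono him
  refine (ncard_Z_le_units hM hRm hanti F j).trans ?_
  have hLd : (0 : ℝ) ≤ ((P.L : ℝ) ^ j) ^ P.d := by positivity
  refine mul_le_mul_of_nonneg_left (Finset.sum_le_sum fun i _ => ?_) hLd
  refine mul_le_mul_of_nonneg_left ?_ (Nat.cast_nonneg _)
  exact pow_le_pow_left₀ (cgeo_nonneg (hRm i)) (cgeo_collarPrinted_le R₁ hr hg i) _

/-- The flow count for print's site-to-block letter of the rule. [cite: Balaban1985UV3, p.268; (41) p.266] -/
theorem ncard_Z_pt_le_flow {M₁ : ℕ} (hM : 0 < M₁) {R₁ r₀ : ℝ} (hR : 0 ≤ R₁) (hr : 0 ≤ r₀) {g : ℕ → ℝ}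
    (hg : ∀ j, 0 < g j ∧ g j ≤ 1) (hmono : Monotone g) (F : ℕ → Set (Site P 0)) (j : ℕ) :
    ((Z (ruleSeqPt P M₁ (collarPrinted R₁ r₀ g) Set.univ F) j).ncard : ℝ) ≤
      ((P.L : ℝ) ^ j) ^ P.d *
        ∑ i ∈ Finset.range (j + 1), ((F i).ncard : ℝ) * (cgeo P M₁ R₁ * xlog (g i) ^ r₀) ^ P.d := by
  refine le_trans ?_ (ncard_Z_le_flow hM hR hr hg hmono F j)
  have hfin : (Z (ruleSeq P M₁ (collarPrinted R₁ r₀ g) Set.univ F) j).Finite := by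
    show ((omegaSeq P M₁ (collarPrinted R₁ r₀ g) Set.univ F (j + 1))ᶜ : Set (Site P 0)).Finite
    exact Set.toFinite _
  exact_mod_cast Set.ncard_le_ncard (Z_ruleSeqPt_subset M₁ _ Set.univ F j) hfin

end Flow

/-! ## §7 Large-field PLAQUETTES: the corner-point sets of (8)/(48) and the count per plaquette -/

section Plaquettes

open scoped Classical

/-- A plaquette has at most four corner points in `T_η` (`B10Eq38TorusDomains.cornerSet`). [cite: Balaban1985UV3, (8) p.258] -/
theorem ncard_cornerSet_le (j : ℕ) (p : Plaq P j) : (cornerSet j p).ncard ≤ 4 := by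
  unfold cornerSet
  refine (Set.ncard_insert_le _ _).trans ?_
  have h1 := Set.ncard_insert_le (toFine j (p.src.shift p.μ))
    ({toFine j (p.src.shift p.ν), toFine j ((p.src.shift p.μ).shift p.ν)} : Set (Site P 0))
  have h2 := Set.ncard_insert_le (toFine j (p.src.shift p.ν))
    ({toFine j ((p.src.shift p.μ).shift p.ν)} : Set (Site P 0))
  rw [Set.ncard_singleton] at h2
  omega

/-- «their distances to P» (p. 257) / «distances to P ∪ Ω_k^{(k)c}» (p. 268) read through the corner points
(`B10Eq38TorusDomains.cornerPts`): a set of `n` large-field plaquettes has at most `4n` corner points. [cite: Balaban1985UV3, p.257; p.268] -/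
theorem ncard_cornerPts_le (j : ℕ) (S : Finset (Plaq P j)) : (cornerPts j S).ncard ≤ 4 * S.card := by
  unfold cornerPts
  have h : (⋃ p ∈ S, cornerSet j p) = ⋃ p ∈ (S : Set (Plaq P j)), cornerSet j p := rfl
  calc (⋃ p ∈ S, cornerSet j p).ncard ≤ ∑ p ∈ S, (cornerSet j p).ncard :=
        Finset.set_ncard_biUnion_le S (cornerSet j)
    _ ≤ ∑ _p ∈ S, 4 := Finset.sum_le_sum fun p _ => ncard_cornerSet_le j p
    _ = 4 * S.card := by rw [Finset.sum_const, smul_eq_mul, mul_comm]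

/-- **THE COUNT PER LARGE-FIELD PLAQUETTE** — the geometric content of the leaf `B10LargeFieldSum.ZvolCover` on print's torus:
along the printed collars and a non-decreasing flow `0 < g_j ≤ 1` (`R₁, r₀ ≥ 0`, `M₁ ≥ 1`), with `P_i` the corner points of the
large-field plaquette sets `S_i` of the passages `i → i+1`,
`|Z_j|_{fine} ≤ (Lʲ)^d Σ_{i≤j} 4|S_i|·(c_g(R₁)·x(g_i)^{r₀})^d` — per plaquette of scale `i`, in `Lʲη`-units, the printed-shape
factor `4(c_g x(g_i)^{r₀})^d` (d = 3: `(c_gρ)³x(g_i)^{3r₀}`, `flow_summand_eq`). [cite: Balaban1985UV3, (39) p.266; (41) p.266; (66) p.273; pp.273–274] -/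
theorem ncard_Z_le_plaquettes {M₁ : ℕ} (hM : 0 < M₁) {R₁ r₀ : ℝ} (hR : 0 ≤ R₁) (hr : 0 ≤ r₀) {g : ℕ → ℝ}
    (hg : ∀ j, 0 < g j ∧ g j ≤ 1) (hmono : Monotone g) (S : (i : ℕ) → Finset (Plaq P i)) (j : ℕ) :
    ((Z (ruleSeq P M₁ (collarPrinted R₁ r₀ g) Set.univ (fun i => cornerPts i (S i))) j).ncard : ℝ) ≤
      ((P.L : ℝ) ^ j) ^ P.d *
        ∑ i ∈ Finset.range (j + 1), 4 * ((S i).card : ℝ) * (cgeo P M₁ R₁ * xlog (g i) ^ r₀) ^ P.d := by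
  refine (ncard_Z_le_flow hM hR hr hg hmono _ j).trans ?_
  have hLd : (0 : ℝ) ≤ ((P.L : ℝ) ^ j) ^ P.d := by positivity
  refine mul_le_mul_of_nonneg_left (Finset.sum_le_sum fun i _ => ?_) hLd
  have hc : 0 ≤ (cgeo P M₁ R₁ * xlog (g i) ^ r₀) ^ P.d := by
    have h1 : 0 ≤ cgeo P M₁ R₁ := cgeo_nonneg hR
    have h2 : 0 ≤ xlog (g i) ^ r₀ := Real.rpow_nonneg (by linarith [one_le_xlog (hg i).1 (hg i).2]) _
    positivity
  have hF : ((cornerPts i (S i)).ncard : ℝ) ≤ 4 * ((S i).card : ℝ) := by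
    exact_mod_cast ncard_cornerPts_le i (S i)
  exact mul_le_mul_of_nonneg_right hF hc

/-- The per-plaquette count for print's site-to-block letter of the rule (`ruleSeqPt`). [cite: Balaban1985UV3, p.268; (41) p.266] -/
theorem ncard_Z_pt_le_plaquettes {M₁ : ℕ} (hM : 0 < M₁) {R₁ r₀ : ℝ} (hR : 0 ≤ R₁) (hr : 0 ≤ r₀)
    {g : ℕ → ℝ} (hg : ∀ j, 0 < g j ∧ g j ≤ 1) (hmono : Monotone g) (S : (i : ℕ) → Finset (Plaq P i)) (j : ℕ) :
    ((Z (ruleSeqPt P M₁ (collarPrinted R₁ r₀ g) Set.univ (fun i => cornerPts i (S i))) j).ncard : ℝ) ≤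
      ((P.L : ℝ) ^ j) ^ P.d *
        ∑ i ∈ Finset.range (j + 1), 4 * ((S i).card : ℝ) * (cgeo P M₁ R₁ * xlog (g i) ^ r₀) ^ P.d := by
  refine le_trans ?_ (ncard_Z_le_plaquettes hM hR hr hg hmono S j)
  have hfin : (Z (ruleSeq P M₁ (collarPrinted R₁ r₀ g) Set.univ (fun i => cornerPts i (S i))) j).Finite := by
    show ((omegaSeq P M₁ (collarPrinted R₁ r₀ g) Set.univ (fun i => cornerPts i (S i)) (j + 1))ᶜ :
      Set (Site P 0)).Finite
    exact Set.toFinite _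
  exact_mod_cast Set.ncard_le_ncard (Z_ruleSeqPt_subset M₁ _ Set.univ _ j) hfin

/-- The printed-shape summand: `(c·x^{r₀})ⁿ = cⁿ·x^{n r₀}` for `x ≥ 0` — at `n = d = 3` the factor `(c_gρ)³·x(g_i)^{3r₀}` of the
leaf `B10LargeFieldSum.ZvolCover`. [cite: Balaban1985UV3, (39) p.266] -/
theorem flow_summand_eq (c : ℝ) {x : ℝ} (hx : 0 ≤ x) (r₀ : ℝ) (n : ℕ) :
    (c * x ^ r₀) ^ n = c ^ n * x ^ ((n : ℝ) * r₀) := by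
  rw [mul_pow, mul_comm (n : ℝ) r₀, Real.rpow_mul hx, Real.rpow_natCast]

end Plaquettes



end Literature.MathematicalPhysics.QuantumFieldTheory.Balaban1983to89.B10Eq39CollarVolume

end
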